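import Summits.AtomisticToContinuum.Crystallization.Theorems.FreeSplittingCertificatesStrictSplittingRuleP1Reproduce
import Summits.AtomisticToContinuum.Crystallization.Theorems.FreeSplittingCertificatesStrictSplittingRuleP1BareWeight
import Summits.AtomisticToContinuum.Crystallization.Theorems.FreeSplittingCertificatesStrictSplittingRuleP1VertexRegroup

/-!
# `StrictSplittingRule` (stmt-AtomisticToContinuum-12560): THE HAT-AVERAGED FAR SHARES VANISH AT INNER SITES — cells inside the inner sphere (P1 interpolant object, part 66)

Route `FreeSplittingCertificates`, crux r3 `StrictSplittingRule` (H12⋆ = `stub_coreJointCoercive`), unit b2b-freesplit-B gen 33.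
VALUE = the kernel fact the table hypothesis (TAB) of the endpoint needs at the INNER sites of the reach set, where the cell's tables carry `(L, U) = (0, 0)`
(HOME FAR-LEMMA-SPEC §24 (f)): if every vertex of every cell cornering at `q` lies in the closed inner ball `|y − y_p|² ≤ R₁²`, then the hat-averaged far shares
`H_rad,q`, `H_cred,q` (`p1SiteBare` with the ledger's `χ²`-weights re-centred at `y_p`) are ZERO — the cells are convex hulls of their vertices (`sum_p1Lam_mul_hcpSite`,
barycentric Jensen via `p1_variance_identity`), the ball is convex, and `χ = 0` on `|x|² ≤ R₁²`:
* `fpSq_sub_le_of_mem_p1RealCell` — `|y − y₀|² ≤ S` on a cell all of whose vertices satisfy it;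
* `p1CellBare_eq_zero_of_inner`, **`p1SiteBare_eq_zero_of_inner`** (generic weight vanishing on the inner ball), and the criterion by the 27 cube offsets
  **`p1SiteBare_eq_zero_of_cube_inner`**; instances `p1Quad3_radWeight_eq_zero_of_le`, `p1Quad3_credWeight_eq_zero_of_le` for the ledger's weights.
NOT a proof of H12⋆, NOT summit progress.  [folklore]
-/

noncomputable section

open Set Function Metric MeasureTheory Filter Topology
open scoped BigOperators NNReal ENNReal Classical

namespace Summit.AtomisticToContinuum.Crystallization.Theorems.StrictSplittingRuleBirth

open Literature.MathematicalPhysics.StatisticalMechanics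
open Summit.AtomisticToContinuum.Crystallization.Theorems.PalmUnimodularRigidity.LayeredLawsSelectHcp

/-! ## Cells are inside any ball containing their vertices -/

/-- **Barycentric Jensen on a cell**: if the four vertices `y_v` of the cell `T` satisfy `|y_v − y₀|² ≤ S`, so does every `y ∈ T`. -/
theorem fpSq_sub_le_of_mem_p1RealCell {a h : ℝ} (ha : a ≠ 0) (hh : h ≠ 0) {i : (ℤ × ℤ × ℤ) × Fin 6} {y : Fin 3 → ℝ}
    (hy : y ∈ p1RealCell a h i) (y₀ : Fin 3 → ℝ) {S : ℝ}
    (hv : ∀ m : Fin 4, fpSq ((fun k => hcpSite a h (i.1 + p1VertOff (p1Par i.1) i.2 m) k) - y₀) ≤ S) : fpSq (y - y₀) ≤ S := by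
  set lam : Fin 4 → ℝ := fun m => p1Lam a h i m y with hlam
  set w : Fin 4 → Fin 3 → ℝ := fun m => (fun k => hcpSite a h (i.1 + p1VertOff (p1Par i.1) i.2 m) k) - y₀ with hw
  have hl0 : ∀ m, 0 ≤ lam m := fun m => p1Lam_nonneg_of_mem hy m
  have hl1 : ∑ m, lam m = 1 := sum_p1Lam_eq_one a h i y
  have hrep : y - y₀ = fun k => ∑ m, lam m * w m k := by
    funext k
    have h1 := sum_p1Lam_mul_hcpSite ha hh hy k
    have h2 : ∑ m, p1Lam a h i m y = 1 := sum_p1Lam_eq_one a h i y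
    simp only [Pi.sub_apply, hw, hlam, mul_sub, Finset.sum_sub_distrib, ← Finset.sum_mul, h2, one_mul, h1]
  have hvar := p1_variance_identity (fun k l => if k = l then 1 else 0) lam hl1 w
  have hnn : 0 ≤ 1 / 2 * ∑ i', ∑ j, lam i' * lam j * p1Quad3 (fun k l => if k = l then 1 else 0) (w i' - w j) :=
    mul_nonneg (by norm_num) (Finset.sum_nonneg fun i' _ => Finset.sum_nonneg fun j _ =>
      mul_nonneg (mul_nonneg (hl0 i') (hl0 j)) (p1Quad3_one_nonneg _))
  have hq : fpSq (y - y₀) = p1Quad3 (fun k l => if k = l then 1 else 0) (fun k => ∑ m, lam m * w m k) := by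
    rw [hrep, p1Quad3_one]; rfl
  have hle : ∑ m, lam m * p1Quad3 (fun k l => if k = l then 1 else 0) (w m) ≤ ∑ m, lam m * S :=
    Finset.sum_le_sum fun m _ => mul_le_mul_of_nonneg_left (by rw [p1Quad3_one]; exact hv m) (hl0 m)
  rw [← Finset.sum_mul, hl1, one_mul] at hle
  linarith

/-! ## Vanishing of the cell and site forms on the inner ball -/

/-- **A cell inside the inner ball contributes nothing**: if the weight form vanishes on `|y − y₀|² ≤ S₁` and all four vertices of `T` are in that ball, `p1CellBare … T m = 0`. -/
theorem p1CellBare_eq_zero_of_inner {a h : ℝ} (ha : a ≠ 0) (hh : h ≠ 0) (W : (Fin 3 → ℝ) → Fin 3 → Fin 3 → ℝ) (y₀ : Fin 3 → ℝ) {S1 : ℝ}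
    (hW : ∀ y, fpSq (y - y₀) ≤ S1 → ∀ v, p1Quad3 (W y) v = 0) (V : ℤ × ℤ × ℤ → (Fin 3 → ℝ)) (i : (ℤ × ℤ × ℤ) × Fin 6)
    (hv : ∀ m : Fin 4, fpSq ((fun k => hcpSite a h (i.1 + p1VertOff (p1Par i.1) i.2 m) k) - y₀) ≤ S1) (m : Fin 4) :
    p1CellBare a h W V i m = 0 :=
  setIntegral_eq_zero_of_forall_eq_zero fun y hy => by rw [hW y (fpSq_sub_le_of_mem_p1RealCell ha hh hy y₀ hv), mul_zero]

/-- **THE HAT-AVERAGED SHARE AT `q` VANISHES when every cell cornering at `q` has all its vertices in the inner ball.** -/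
theorem p1SiteBare_eq_zero_of_inner {a h : ℝ} (ha : a ≠ 0) (hh : h ≠ 0) (W : (Fin 3 → ℝ) → Fin 3 → Fin 3 → ℝ) (y₀ : Fin 3 → ℝ) {S1 : ℝ}
    (hW : ∀ y, fpSq (y - y₀) ≤ S1 → ∀ v, p1Quad3 (W y) v = 0) (V : ℤ × ℤ × ℤ → (Fin 3 → ℝ)) (q : ℤ × ℤ × ℤ)
    (hq : ∀ o ∈ p1Corners, ∀ (π : Fin 6) (m' : Fin 4),
      fpSq ((fun k => hcpSite a h ((q - o) + p1VertOff (p1Par (q - o)) π m') k) - y₀) ≤ S1) :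
    p1SiteBare a h W V q = 0 := by
  unfold p1SiteBare
  refine Finset.sum_eq_zero fun o ho => Finset.sum_eq_zero fun π _ => Finset.sum_eq_zero fun m _ => ?_
  split_ifs
  · exact p1CellBare_eq_zero_of_inner ha hh W y₀ hW V (q - o, π) (fun m' => hq o ho π m') m
  · rfl

/-- **Criterion by the 27 cube offsets**: if `|y_{q+d} − y₀|² ≤ S₁` for every `d ∈ p1BondOffsets`, every vertex of every cell cornering at `q` is in the inner ball
(vertices of such a cell are `q + (corner − corner)`), hence `p1SiteBare … q = 0`. -/
theorem p1SiteBare_eq_zero_of_cube_inner {a h : ℝ} (ha : a ≠ 0) (hh : h ≠ 0) (W : (Fin 3 → ℝ) → Fin 3 → Fin 3 → ℝ) (y₀ : Fin 3 → ℝ) {S1 : ℝ}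
    (hW : ∀ y, fpSq (y - y₀) ≤ S1 → ∀ v, p1Quad3 (W y) v = 0) (V : ℤ × ℤ × ℤ → (Fin 3 → ℝ)) (q : ℤ × ℤ × ℤ)
    (hq : ∀ d ∈ p1BondOffsets, fpSq ((fun k => hcpSite a h (q + d) k) - y₀) ≤ S1) :
    p1SiteBare a h W V q = 0 := by
  refine p1SiteBare_eq_zero_of_inner ha hh W y₀ hW V q fun o ho π m' => ?_
  have hmem : p1VertOff (p1Par (q - o)) π m' - o ∈ p1BondOffsets := sub_mem_p1BondOffsets ho (p1VertOff_mem_p1Corners _ π m')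
  have e : q - o + p1VertOff (p1Par (q - o)) π m' = q + (p1VertOff (p1Par (q - o)) π m' - o) := by abel
  rw [e]
  exact hq _ hmem

/-! ## The ledger's weights vanish on the inner ball -/

/-- The radial-deficit weight form `cχ²(y−y₀)|y−y₀|⁻¹⁰⟪y−y₀,·⟫²` vanishes for `|y − y₀|² ≤ S₁`. -/
theorem p1Quad3_radWeight_eq_zero_of_le {S1 S2 : ℝ} (hS12 : S1 < S2) (c : ℝ) (y₀ : Fin 3 → ℝ) :
    ∀ y : Fin 3 → ℝ, fpSq (y - y₀) ≤ S1 → ∀ v : Fin 3 → ℝ,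
      p1Quad3 (fun k l => c * fpChi S1 S2 (y - y₀) ^ 2 * (fpSq (y - y₀))⁻¹ ^ 5 * ((y - y₀) k * (y - y₀) l)) v = 0 := by
  intro y hy v
  rw [p1Quad3_radWeight, fpChi_eq_zero hS12 hy]
  ring

/-- The credit weight form `c'χ²(y−y₀)|y−y₀|⁻⁸|·|²` vanishes for `|y − y₀|² ≤ S₁`. -/
theorem p1Quad3_credWeight_eq_zero_of_le {S1 S2 : ℝ} (hS12 : S1 < S2) (c : ℝ) (y₀ : Fin 3 → ℝ) :
    ∀ y : Fin 3 → ℝ, fpSq (y - y₀) ≤ S1 → ∀ v : Fin 3 → ℝ,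
      p1Quad3 (fun k l => c * fpChi S1 S2 (y - y₀) ^ 2 * (fpSq (y - y₀))⁻¹ ^ 4 * (if k = l then 1 else 0)) v = 0 := by
  intro y hy v
  rw [p1Quad3_credWeight, fpChi_eq_zero hS12 hy]
  ring

/-- **THE LEDGER'S HAT-AVERAGED FAR SHARES VANISH AT AN INNER SITE** (both weights, re-centred at `y_p`): `|y_{q+d} − y_p|² ≤ R₁²` for all `d ∈ p1BondOffsets` ⇒
`H_rad,q = H_cred,q = 0` for every value argument.  NOT a proof of H12⋆, NOT summit progress. -/
theorem p1SiteBare_ledger_eq_zero_of_cube_inner {a h : ℝ} (ha : a ≠ 0) (hh : h ≠ 0) {R1 R2 : ℝ} (hR1 : 0 < R1) (hR12 : R1 < R2) (κ : ℝ)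
    (p q : ℤ × ℤ × ℤ) (hq : ∀ d ∈ p1BondOffsets, fpSq ((fun k => hcpSite a h (q + d) k) - fun k => hcpSite a h p k) ≤ R1 ^ 2)
    (V : ℤ × ℤ × ℤ → (Fin 3 → ℝ)) :
    p1SiteBare a h (fun y k l => κ * ((7 * (5 / 4 : ℝ) + 3 / 4) / 4) * fpChi (R1 ^ 2) (R2 ^ 2) (y - fun k => hcpSite a h p k) ^ 2 *
        (fpSq (y - fun k => hcpSite a h p k))⁻¹ ^ 5 * ((y - fun k => hcpSite a h p k) k * (y - fun k => hcpSite a h p k) l)) V q = 0 ∧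
    p1SiteBare a h (fun y k l => κ * ((3 / 4 : ℝ) / 4) * fpChi (R1 ^ 2) (R2 ^ 2) (y - fun k => hcpSite a h p k) ^ 2 *
        (fpSq (y - fun k => hcpSite a h p k))⁻¹ ^ 4 * (if k = l then 1 else 0)) V q = 0 := by
  have hS12 : R1 ^ 2 < R2 ^ 2 := pow_lt_pow_left₀ hR12 hR1.le two_ne_zero
  exact ⟨p1SiteBare_eq_zero_of_cube_inner ha hh _ _ (p1Quad3_radWeight_eq_zero_of_le hS12 _ _) V q hq,
    p1SiteBare_eq_zero_of_cube_inner ha hh _ _ (p1Quad3_credWeight_eq_zero_of_le hS12 _ _) V q hq⟩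

end Summit.AtomisticToContinuum.Crystallization.Theorems.StrictSplittingRuleBirth

end
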